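import Mathlib
import Summits.PneNP.PneNP.Theorems.SfmBlSignedModel
import Summits.PneNP.PneNP.Theorems.SfmBlLegModel

/-!
# Leg counts: the abstract output matrices of Prop. 7 from a leg structure — line «sfm-bl»

FRONTIER F-N1c; nothing here bears on P vs NP.

Bridge between the LEG MODEL (`SfmBlLegModel`: legs `l` with endpoints `src l : α`, `dst l : β`; here also
an output map `out l : Fin m`) and the ABSTRACT OUTPUT-SHARED-SIGN MODEL of Prop. 7 (`SfmBlSignedModel`,
`SfmBlProp7`: one matrix `B j : Matrix α β ℝ` per output).  Definition-free: `B` is any family satisfying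
`hBdef : B j i k = #{l : out l = j, src l = i, dst l = k}` (the LEG COUNTS; for the remainder `R` of the
algorithm take the leg type `Λ :=` the subtype of remainder legs).  Proved here:
* `legMatrix_weighted_sum` / `legMatrix_weighted_total`: `Σ_{i,k} B j i k·g i k = Σ_{l ∈ out⁻¹ j} g (src l) (dst l)`;
* the hypotheses of Prop. 7 (`SfmBl.sum_trace_pow_le`) read off the legs: `legMatrix_nonneg` (`hB`),
  `legMatrix_sum_entries(_le)` (`hlegs`: entry sum of `B j` = number of legs of `j`, `≤ 3`),
  `legMatrix_row_sum(_le)` / `legMatrix_col_sum(_le)` (`hrow`/`hcol`: = leg-degree of the piece, `≤ L`),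
  `legMatrix_ne_zero` (`hG`: support ⊆ legs);
* `sgnMat_apply_legs`: `sgnMat B T i k = Σ_{l : src l = i, dst l = k} χ(T (out l))` — i.e. `sgnMat B T` has
  exactly the shape `hM` of `SfmBlLegModel.bilin_eq_sum_legs` / `SfmBlSpotAccounting` with edge signs
  `s l = χ(T (out l))`; hence `dotProduct_sgnMat_mulVec_legs` and, for the full leg set `Fin m × Fin 3` of a
  pure-CAND instance, `not_mem_range_of_sgnMat_cut_lt`: `(∀ ±1 σ φ, σᵀ(sgnMat B T)φ < m) → T ∉ range I`
  (via the landed `cutCertified_of_matrix_cut_lt` and `cand_cut_certificate`).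
-/

namespace Summit.PneNP.PneNP.Theorems.SfmBl

open Matrix Finset BigOperators
open Literature.Computability.Complexity (LocalMap candPred)

variable {α β Λ : Type} [Fintype α] [Fintype β] [Fintype Λ] [DecidableEq α] [DecidableEq β] {m : ℕ}

/-- LEG BOOKKEEPING: a weighted entry sum of the leg-count matrix of output `j` is the sum of the weight over
the legs of `j`. -/
theorem legMatrix_weighted_sum (B : Fin m → Matrix α β ℝ) (out : Λ → Fin m) (src : Λ → α) (dst : Λ → β)
    (hBdef : ∀ j i k, B j i k = ((univ.filter (fun l => out l = j ∧ src l = i ∧ dst l = k)).card : ℝ))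
    (g : α → β → ℝ) (j : Fin m) :
    ∑ i, ∑ k, B j i k * g i k = ∑ l ∈ univ.filter (fun l => out l = j), g (src l) (dst l) := by
  have key : ∀ l, (∑ i, ∑ k, (if out l = j ∧ src l = i ∧ dst l = k then g i k else 0))
      = if out l = j then g (src l) (dst l) else 0 := by
    intro l
    by_cases hp : out l = j
    · simp only [hp, true_and, if_true]
      rw [Finset.sum_eq_single (src l)]
      · rw [Finset.sum_eq_single (dst l)]
        · simp
        · intro k _ hk; simp [Ne.symm hk]
        · simp
      · intro i _ hi
        simp [Ne.symm hi]
      · simp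
    · simp [hp]
  calc ∑ i, ∑ k, B j i k * g i k
      = ∑ i, ∑ k, ∑ l, (if out l = j ∧ src l = i ∧ dst l = k then g i k else 0) := by
        refine sum_congr rfl fun i _ => sum_congr rfl fun k _ => ?_
        rw [hBdef, Finset.card_filter, Nat.cast_sum, Finset.sum_mul]
        refine sum_congr rfl fun l _ => ?_
        split_ifs <;> simp
    _ = ∑ l, ∑ i, ∑ k, (if out l = j ∧ src l = i ∧ dst l = k then g i k else 0) := by
        have hsw : ∀ i, (∑ k, ∑ l, (if out l = j ∧ src l = i ∧ dst l = k then g i k else 0))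
            = ∑ l, ∑ k, (if out l = j ∧ src l = i ∧ dst l = k then g i k else 0) :=
          fun i => Finset.sum_comm
        simp_rw [hsw]
        exact Finset.sum_comm
    _ = ∑ l, (if out l = j then g (src l) (dst l) else 0) := sum_congr rfl fun l _ => key l
    _ = ∑ l ∈ univ.filter (fun l => out l = j), g (src l) (dst l) := (Finset.sum_filter _ _).symm

/-- Total weighted sum over all outputs = sum over all legs. -/
theorem legMatrix_weighted_total (B : Fin m → Matrix α β ℝ) (out : Λ → Fin m) (src : Λ → α) (dst : Λ → β)
    (hBdef : ∀ j i k, B j i k = ((univ.filter (fun l => out l = j ∧ src l = i ∧ dst l = k)).card : ℝ))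
    (g : α → β → ℝ) :
    ∑ j, ∑ i, ∑ k, B j i k * g i k = ∑ l, g (src l) (dst l) := by
  simp_rw [legMatrix_weighted_sum B out src dst hBdef g]
  exact Finset.sum_fiberwise univ out (fun l => g (src l) (dst l))

omit [Fintype α] [Fintype β] in
/-- Leg counts are nonnegative (hypothesis `hB` of the abstract model). -/
theorem legMatrix_nonneg (B : Fin m → Matrix α β ℝ) (out : Λ → Fin m) (src : Λ → α) (dst : Λ → β)
    (hBdef : ∀ j i k, B j i k = ((univ.filter (fun l => out l = j ∧ src l = i ∧ dst l = k)).card : ℝ))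
    (j : Fin m) (i : α) (k : β) : 0 ≤ B j i k := by
  rw [hBdef]; exact Nat.cast_nonneg _

/-- The entry sum of `B j` is the number of legs of output `j` (so `≤ 3` for a 3-local map: hypothesis `hlegs`). -/
theorem legMatrix_sum_entries (B : Fin m → Matrix α β ℝ) (out : Λ → Fin m) (src : Λ → α) (dst : Λ → β)
    (hBdef : ∀ j i k, B j i k = ((univ.filter (fun l => out l = j ∧ src l = i ∧ dst l = k)).card : ℝ))
    (j : Fin m) : ∑ i, ∑ k, B j i k = ((univ.filter (fun l => out l = j)).card : ℝ) := by
  have h := legMatrix_weighted_sum B out src dst hBdef (fun _ _ => 1) j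
  simpa using h

/-- `hlegs`: at most three legs per output. -/
theorem legMatrix_sum_entries_le (B : Fin m → Matrix α β ℝ) (out : Λ → Fin m) (src : Λ → α) (dst : Λ → β)
    (hBdef : ∀ j i k, B j i k = ((univ.filter (fun l => out l = j ∧ src l = i ∧ dst l = k)).card : ℝ))
    {d : ℕ} (hout : ∀ j, (univ.filter (fun l => out l = j)).card ≤ d) (j : Fin m) :
    ∑ i, ∑ k, B j i k ≤ d := by
  rw [legMatrix_sum_entries B out src dst hBdef j]; exact_mod_cast hout j

/-- Row sums of the unsigned model = leg-degree of the left piece. -/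
theorem legMatrix_row_sum (B : Fin m → Matrix α β ℝ) (out : Λ → Fin m) (src : Λ → α) (dst : Λ → β)
    (hBdef : ∀ j i k, B j i k = ((univ.filter (fun l => out l = j ∧ src l = i ∧ dst l = k)).card : ℝ))
    (i : α) : ∑ j, ∑ k, B j i k = ((univ.filter (fun l => src l = i)).card : ℝ) := by
  have h := legMatrix_weighted_total B out src dst hBdef (fun i' _ => if i' = i then 1 else 0)
  have hl : ∀ j, (∑ i', ∑ k, B j i' k * (if i' = i then (1 : ℝ) else 0)) = ∑ k, B j i k := by
    intro j
    rw [Finset.sum_comm]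
    refine sum_congr rfl fun k _ => ?_
    simp only [mul_ite, mul_one, mul_zero, Finset.sum_ite_eq', Finset.mem_univ, if_true]
  simp_rw [hl] at h
  rw [h, Finset.card_filter, Nat.cast_sum]
  refine sum_congr rfl fun l _ => ?_
  split_ifs <;> simp

/-- `hrow`: left pieces of leg-degree `≤ L`. -/
theorem legMatrix_row_sum_le (B : Fin m → Matrix α β ℝ) (out : Λ → Fin m) (src : Λ → α) (dst : Λ → β)
    (hBdef : ∀ j i k, B j i k = ((univ.filter (fun l => out l = j ∧ src l = i ∧ dst l = k)).card : ℝ))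
    {L : ℕ} (hdegL : ∀ i, (univ.filter (fun l => src l = i)).card ≤ L) (i : α) :
    ∑ j, ∑ k, B j i k ≤ L := by
  rw [legMatrix_row_sum B out src dst hBdef i]; exact_mod_cast hdegL i

/-- Column sums of the unsigned model = leg-degree of the right piece. -/
theorem legMatrix_col_sum (B : Fin m → Matrix α β ℝ) (out : Λ → Fin m) (src : Λ → α) (dst : Λ → β)
    (hBdef : ∀ j i k, B j i k = ((univ.filter (fun l => out l = j ∧ src l = i ∧ dst l = k)).card : ℝ))
    (k : β) : ∑ j, ∑ i, B j i k = ((univ.filter (fun l => dst l = k)).card : ℝ) := by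
  have h := legMatrix_weighted_total B out src dst hBdef (fun _ k' => if k' = k then 1 else 0)
  have hl : ∀ j, (∑ i, ∑ k', B j i k' * (if k' = k then (1 : ℝ) else 0)) = ∑ i, B j i k := by
    intro j
    refine sum_congr rfl fun i _ => ?_
    simp only [mul_ite, mul_one, mul_zero, Finset.sum_ite_eq', Finset.mem_univ, if_true]
  simp_rw [hl] at h
  rw [h, Finset.card_filter, Nat.cast_sum]
  refine sum_congr rfl fun l _ => ?_
  split_ifs <;> simp

/-- `hcol`: right pieces of leg-degree `≤ L`. -/
theorem legMatrix_col_sum_le (B : Fin m → Matrix α β ℝ) (out : Λ → Fin m) (src : Λ → α) (dst : Λ → β)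
    (hBdef : ∀ j i k, B j i k = ((univ.filter (fun l => out l = j ∧ src l = i ∧ dst l = k)).card : ℝ))
    {L : ℕ} (hdegR : ∀ k, (univ.filter (fun l => dst l = k)).card ≤ L) (k : β) :
    ∑ j, ∑ i, B j i k ≤ L := by
  rw [legMatrix_col_sum B out src dst hBdef k]; exact_mod_cast hdegR k

omit [Fintype α] [Fintype β] in
/-- Support of the model ⊆ legs (hypothesis `hG` of Prop. 7 for the piece graph whose edges are the legs). -/
theorem legMatrix_ne_zero (B : Fin m → Matrix α β ℝ) (out : Λ → Fin m) (src : Λ → α) (dst : Λ → β)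
    (hBdef : ∀ j i k, B j i k = ((univ.filter (fun l => out l = j ∧ src l = i ∧ dst l = k)).card : ℝ))
    {j : Fin m} {i : α} {k : β} (h : B j i k ≠ 0) : ∃ l, out l = j ∧ src l = i ∧ dst l = k := by
  rw [hBdef, Nat.cast_ne_zero, ← pos_iff_ne_zero, Finset.card_pos, Finset.filter_nonempty_iff] at h
  obtain ⟨l, -, hl⟩ := h
  exact ⟨l, hl⟩

/-- The bilinear form of one output matrix, leg by leg. -/
theorem dotProduct_legMatrix_mulVec (B : Fin m → Matrix α β ℝ) (out : Λ → Fin m) (src : Λ → α) (dst : Λ → β)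
    (hBdef : ∀ j i k, B j i k = ((univ.filter (fun l => out l = j ∧ src l = i ∧ dst l = k)).card : ℝ))
    (σ : α → ℝ) (φ : β → ℝ) (j : Fin m) :
    σ ⬝ᵥ (B j *ᵥ φ) = ∑ l ∈ univ.filter (fun l => out l = j), σ (src l) * φ (dst l) := by
  rw [← legMatrix_weighted_sum B out src dst hBdef (fun i k => σ i * φ k) j]
  simp only [dotProduct, Matrix.mulVec, Finset.mul_sum]
  refine sum_congr rfl fun i _ => sum_congr rfl fun k _ => ?_
  ring

omit [Fintype α] [Fintype β] in
/-- THE SIGNED MODEL HAS THE LEG SHAPE: `sgnMat B T i k = Σ_{l : src l = i, dst l = k} χ(T (out l))`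
(hypothesis `hM` of `bilin_eq_sum_legs` / `spot_cut_le` with `s l = χ(T (out l))`). -/
theorem sgnMat_apply_legs (B : Fin m → Matrix α β ℝ) (out : Λ → Fin m) (src : Λ → α) (dst : Λ → β)
    (hBdef : ∀ j i k, B j i k = ((univ.filter (fun l => out l = j ∧ src l = i ∧ dst l = k)).card : ℝ))
    (T : Fin m → Bool) (i : α) (k : β) :
    sgnMat B T i k = ∑ l ∈ univ.filter (fun l => src l = i ∧ dst l = k),
      ((CandCutNorm.boolSign (T (out l)) : ℤ) : ℝ) := by
  rw [sgnMat_apply]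
  have h1 : ∀ j, ((CandCutNorm.boolSign (T j) : ℤ) : ℝ) * B j i k
      = ∑ l ∈ (univ.filter (fun l => src l = i ∧ dst l = k)).filter (fun l => out l = j),
          ((CandCutNorm.boolSign (T (out l)) : ℤ) : ℝ) := by
    intro j
    rw [hBdef, Finset.cast_card, Finset.mul_sum, Finset.filter_filter]
    have hset : univ.filter (fun l => out l = j ∧ src l = i ∧ dst l = k)
        = univ.filter (fun l => (src l = i ∧ dst l = k) ∧ out l = j) := by
      ext l; simp only [Finset.mem_filter, Finset.mem_univ, true_and]; tauto
    rw [hset]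
    refine sum_congr rfl fun l hl => ?_
    rw [mul_one, ((Finset.mem_filter.1 hl).2).2]
  simp_rw [h1]
  exact Finset.sum_fiberwise (univ.filter (fun l => src l = i ∧ dst l = k)) out
    (fun l => ((CandCutNorm.boolSign (T (out l)) : ℤ) : ℝ))

/-- THE SIGNED BILINEAR FORM, LEG BY LEG: `σᵀ(sgnMat B T)φ = Σ_l χ(T (out l))·σ(src l)·φ(dst l)`. -/
theorem dotProduct_sgnMat_mulVec_legs (B : Fin m → Matrix α β ℝ) (out : Λ → Fin m) (src : Λ → α)
    (dst : Λ → β)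
    (hBdef : ∀ j i k, B j i k = ((univ.filter (fun l => out l = j ∧ src l = i ∧ dst l = k)).card : ℝ))
    (T : Fin m → Bool) (σ : α → ℝ) (φ : β → ℝ) :
    σ ⬝ᵥ (sgnMat B T *ᵥ φ)
      = ∑ l, ((CandCutNorm.boolSign (T (out l)) : ℤ) : ℝ) * σ (src l) * φ (dst l) :=
  bilin_eq_sum_legs src dst _ (sgnMat B T) (sgnMat_apply_legs B out src dst hBdef T) σ φ

/-- END-TO-END CERTIFICATE in the abstract model (LEMMA 1 + free splitting): for a pure-CAND instance
with full leg set `Fin m × Fin 3` placed on pieces of the right owners (`own₁ ∘ src = c_j`; `own₂ ∘ dst =`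
constant / `a_j` / `b_j`) and `B` the leg counts, a signing with `σᵀ(sgnMat B T)φ < m` for all `±1` piece
vectors lies outside the range. -/
theorem not_mem_range_of_sgnMat_cut_lt {n : ℕ} (I : LocalMap 3 n m) (hI : I.IsPure candPred)
    (T : Fin m → Bool) (src : Fin m × Fin 3 → α) (dst : Fin m × Fin 3 → β) (own₁ : α → Fin n)
    (own₂ : β → Option (Fin n)) (hsrc : ∀ j ℓ, own₁ (src (j, ℓ)) = I.vars j 0)
    (hz : ∀ j, own₂ (dst (j, 0)) = none) (ha : ∀ j, own₂ (dst (j, 1)) = some (I.vars j 1))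
    (hb : ∀ j, own₂ (dst (j, 2)) = some (I.vars j 2)) (B : Fin m → Matrix α β ℝ)
    (hBdef : ∀ j i k, B j i k = ((univ.filter (fun l : Fin m × Fin 3 =>
      l.1 = j ∧ src l = i ∧ dst l = k)).card : ℝ))
    (h : ∀ (σ : α → ℝ) (φ : β → ℝ), (∀ p, σ p = 1 ∨ σ p = -1) → (∀ q, φ q = 1 ∨ φ q = -1) →
      σ ⬝ᵥ (sgnMat B T *ᵥ φ) < (m : ℝ)) :
    T ∉ I.range :=
  CandCutNorm.cand_cut_certificate I hI T
    (cutCertified_of_matrix_cut_lt I T src dst own₁ own₂ hsrc hz ha hb (sgnMat B T)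
      (sgnMat_apply_legs B Prod.fst src dst hBdef T) h)

end Summit.PneNP.PneNP.Theorems.SfmBl
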